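import Mathlib
import Summits.KontsevichZagierPeriods.Zeta5Search.Families.DualSpanProdCoeff
import Summits.KontsevichZagierPeriods.Zeta5Search.Families.VIMTorusPeriod
import HarnessLib

/-!
# ζ(5) search — Families: the VIM torus period `J` IS the gauge-9 dual constant term (closed 3-fold form for every exponent)

HONEST FRAMING: systematic search; no irrationality claim unless certified.  Exact identities between integers /
integer polynomials (seat P2 g9, Families layer); nothing about the arithmetic of `ζ(5)` or `ζ(7)`; no record moves;
no conjecture node is used or discharged.

OBJECT.  For Brown's `vanishing in the middle' plan `σ = (10,2,4,1,6,3,8,5,9,7)` ([BrownZudilin2022, §12]; tree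
`Families/CellularVIMRecurrenceLaws`, `Families/VIMTorusPeriod`) put the point of label `10` (the LAST point in the
`σ`-order, `τ = σ⁻¹ = (3,1,5,2,7,4,9,6,8,0)` in `0`-indexed labels: the point `9 = τ⁻¹(0)`) at infinity and let
`g₀,…,g₇` be the consecutive differences of the nine finite points in `σ`-order.  The eight finite `δ`-chords
`{0,1},{1,2},…,{7,8}` then span the gap intervals
`[0,1], [0,3], [1,3], [1,5], [3,5], [3,7], [5,7], [5,6]`
(fam-tele g13 `HOME/pub-zeta5-fam-tele/g13/README.md` §3 B5, gauge `τ-point 9 at ∞'), and the `n`-th power of the basic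
integrand is `∏_e (Σ_{w ∈ span e} g_w)ⁿ / ∏_w g_wⁿ`.  `vimSpanProd9 A` is the numerator with an arbitrary exponent `A e`
on each chord (a polynomial in `ℤ[g₀,…,g₇]`); its coefficients are the dual constant terms of the generalised VIM family
in this gauge.

KERNEL CONTENT (standard axioms; the method is cert-2 g7's ordered extraction of `Families/DualSpanProdCoeff`,
[McCarthy–Osburn–Straub 2020, §3.2]):
* `VIMCT9.vimSpanProd9_eq_sum3` — the three binomial splits `g₀ | g₁` of chord `[0,1]`, `(g₁+g₂) | (g₃+g₄+g₅)` of
  `[1,5]`, `(g₃+g₄) | (g₅+g₆+g₇)` of `[3,7]` (fam-tele g13's elimination order, `trackB/vim3fold.py`);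
* `VIMCT9.coeff_term` — the forced extractions `g₀, g₇, g₆, g₅, g₄, g₃, g₂` and the read-off of `g₁`;
* **`VIMCT9.coeff_vimSpanProd9 : [g^m] vimSpanProd9 A = ctSum9 A m`** — a 3-fold sum of products of ten binomial
  coefficients, for EVERY exponent vector `A` and monomial `m` (the VIM analogue of `DualCT.coeff_dualSpanProd`);
* **`VIMCT9.coeff_diag_eq_J : [gⁿ⋯ⁿ] vimSpanProd9 (n,…,n) = VIMTorus.J n`** — fam-tele g13's three-fold chain sum
  `J(n) = Σ_u C(n,u)C(2n−u,n)·M₁(n,u)·M₂(n,u)` (`Families/VIMTorusPeriod`, there a DEFINITION with the derivation only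
  documented) IS the diagonal dual constant term in gauge 9, for every `n`.
What this is NOT: it does not relate `J` to the leading coefficients `A n` of the VIM forms (that is the open node
`VIMTorus.TorusPeriodRecurrence` / D-exact(VIM), untouched here), and says nothing about gauge invariance.
Exact cross-check outside the kernel: `ctSum9` = brute-force expansion on 300 random `(A, m)` with `A e ≤ 3` and on the
diagonal `n ≤ 3` (seat folder `work/vim_ct9_check.py`, 0 mismatches).
-/

noncomputable section

open MvPolynomial Finset

namespace Summit.KontsevichZagierPeriods.Zeta5Search.Families.Cellular

namespace VIMCT9

open DualCT

/-- The polynomial ring `ℤ[g₀,…,g₇]` of the eight finite gaps of the VIM dual cell (gauge 9). -/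
abbrev P8 := MvPolynomial (Fin 8) ℤ

/-- The gauge-9 span product of the VIM dual cell with exponent `A e` on the `e`-th chord, chords in the order
`[0,1], [0,3], [1,3], [1,5], [3,5], [3,7], [5,7], [5,6]` (gap intervals). -/
def vimSpanProd9 (A : Fin 8 → ℕ) : P8 :=
  (X 0 + X 1) ^ A 0 * (X 0 + X 1 + X 2 + X 3) ^ A 1 * (X 1 + X 2 + X 3) ^ A 2 *
    (X 1 + X 2 + X 3 + X 4 + X 5) ^ A 3 * (X 3 + X 4 + X 5) ^ A 4 * (X 3 + X 4 + X 5 + X 6 + X 7) ^ A 5 *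
      (X 5 + X 6 + X 7) ^ A 6 * (X 5 + X 6) ^ A 7

/-! ### STEP 1 — three binomial splits -/

/-- The summand of `vimSpanProd9 A` after the three splits (`i ≤ A 0` the `g₀`-part of `[0,1]`, `u ≤ A 3` the
`(g₁+g₂)`-part of `[1,5]`, `v ≤ A 5` the `(g₃+g₄)`-part of `[3,7]`), arranged for the extraction order
`g₀, g₇, g₆, g₅, g₄, g₃, g₂`. -/
def term (A : Fin 8 → ℕ) (i u v : ℕ) : P8 :=
  X 0 ^ i * ((X 0 + (X 1 + X 2 + X 3)) ^ A 1 *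
    (X 1 ^ (A 0 - i) * ((X 1 + X 2) ^ u * ((X 1 + X 2 + X 3) ^ A 2 *
      ((X 3 + X 4 + X 5) ^ (A 3 - u) * ((X 3 + X 4 + X 5) ^ A 4 * ((X 3 + X 4) ^ v *
        ((X 5 + X 6 + X 7) ^ (A 5 - v) * ((X 5 + X 6 + X 7) ^ A 6 * (X 5 + X 6) ^ A 7)))))))))

/-- STEP 1: `vimSpanProd9 A = Σ_{i ≤ A₀} Σ_{u ≤ A₃} Σ_{v ≤ A₅} C(A₀,i)C(A₃,u)C(A₅,v) · term A i u v`. -/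
theorem vimSpanProd9_eq_sum3 (A : Fin 8 → ℕ) :
    vimSpanProd9 A = ∑ i ∈ range (A 0 + 1), ∑ u ∈ range (A 3 + 1), ∑ v ∈ range (A 5 + 1),
      C (((A 0).choose i : ℤ) * ((A 3).choose u * (A 5).choose v)) * term A i u v := by
  have h0 : (X 0 + X 1 : P8) ^ A 0 =
      ∑ i ∈ range (A 0 + 1), X 0 ^ i * X 1 ^ (A 0 - i) * ((A 0).choose i : P8) := by
    rw [add_pow]
  have h3 : (X 1 + X 2 + X 3 + X 4 + X 5 : P8) ^ A 3 =
      ∑ u ∈ range (A 3 + 1), (X 1 + X 2) ^ u * (X 3 + X 4 + X 5) ^ (A 3 - u) * ((A 3).choose u : P8) := by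
    rw [show (X 1 + X 2 + X 3 + X 4 + X 5 : P8) = (X 1 + X 2) + (X 3 + X 4 + X 5) by ring, add_pow]
  have h5 : (X 3 + X 4 + X 5 + X 6 + X 7 : P8) ^ A 5 =
      ∑ v ∈ range (A 5 + 1), (X 3 + X 4) ^ v * (X 5 + X 6 + X 7) ^ (A 5 - v) * ((A 5).choose v : P8) := by
    rw [show (X 3 + X 4 + X 5 + X 6 + X 7 : P8) = (X 3 + X 4) + (X 5 + X 6 + X 7) by ring, add_pow]
  have h1 : (X 0 + X 1 + X 2 + X 3 : P8) ^ A 1 = (X 0 + (X 1 + X 2 + X 3)) ^ A 1 := by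
    rw [show (X 0 + X 1 + X 2 + X 3 : P8) = X 0 + (X 1 + X 2 + X 3) by ring]
  unfold vimSpanProd9
  rw [h0, Finset.sum_mul, Finset.sum_mul, Finset.sum_mul, Finset.sum_mul, Finset.sum_mul, Finset.sum_mul,
    Finset.sum_mul]
  refine Finset.sum_congr rfl fun i _ => ?_
  rw [h3, Finset.mul_sum, Finset.sum_mul, Finset.sum_mul, Finset.sum_mul, Finset.sum_mul]
  refine Finset.sum_congr rfl fun u _ => ?_
  rw [h5, Finset.mul_sum, Finset.sum_mul, Finset.sum_mul]
  refine Finset.sum_congr rfl fun v _ => ?_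
  rw [h1]
  unfold term
  simp only [← C_eq_coe_nat, map_mul]
  ring

/-! ### STEP 2 — the chain of extractions -/

/-- The multi-index left after erasing the slots `0,7,6,5,4,3,2` is `(m 1)·e₁`. -/
theorem idx_eq (m : Fin 8 →₀ ℕ) :
    ((((((m.erase 0).erase 7).erase 6).erase 5).erase 4).erase 3).erase 2 = Finsupp.single 1 (m 1) := by
  ext w
  fin_cases w <;> simp

/-- The coefficient of `g^m` in `term A i u v`: seven binomial coefficients and four guards (the `g₀`-, `g₅`- and
`g₃`-budgets of the monomial prefixes and the forced `g₁`-exponent).  Abbreviations (all `ℕ` subtractions):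
`N₇ = A₅ − v + A₆` (merged `(g₅+g₆+g₇)`-power), `N₈ = N₇ − m₇ + A₇` (merged `(g₅+g₆)`-power), `c = N₈ − m₆` (the `g₅`-prefix),
`N₅ = A₃ − u + A₄`, `K = N₅ − (m₅ − c) + v` (merged `(g₃+g₄)`-power), `d = K − m₄` (the `g₃`-prefix),
`M₃ = A₁ − (m₀ − i) + A₂`, `L = M₃ − (m₃ − d) + u` (merged `(g₁+g₂)`-power). -/
def termCoeff (A : Fin 8 → ℕ) (m : Fin 8 → ℕ) (i u v : ℕ) : ℤ :=
  if i ≤ m 0 then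
    ((A 1).choose (m 0 - i) : ℤ) *
      (((A 5 - v + A 6).choose (m 7) : ℤ) *
        (((A 5 - v + A 6 - m 7 + A 7).choose (m 6) : ℤ) *
          (if A 5 - v + A 6 - m 7 + A 7 - m 6 ≤ m 5 then
            ((A 3 - u + A 4).choose (m 5 - (A 5 - v + A 6 - m 7 + A 7 - m 6)) : ℤ) *
              (((A 3 - u + A 4 - (m 5 - (A 5 - v + A 6 - m 7 + A 7 - m 6)) + v).choose (m 4) : ℤ) *
                (if A 3 - u + A 4 - (m 5 - (A 5 - v + A 6 - m 7 + A 7 - m 6)) + v - m 4 ≤ m 3 then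
                  ((A 1 - (m 0 - i) + A 2).choose
                      (m 3 - (A 3 - u + A 4 - (m 5 - (A 5 - v + A 6 - m 7 + A 7 - m 6)) + v - m 4)) : ℤ) *
                    (((A 1 - (m 0 - i) + A 2 -
                          (m 3 - (A 3 - u + A 4 - (m 5 - (A 5 - v + A 6 - m 7 + A 7 - m 6)) + v - m 4)) + u).choose
                        (m 2) : ℤ) *
                      (if A 1 - (m 0 - i) + A 2 -
                            (m 3 - (A 3 - u + A 4 - (m 5 - (A 5 - v + A 6 - m 7 + A 7 - m 6)) + v - m 4)) + u -
                            m 2 + (A 0 - i) = m 1 then 1 else 0))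
                else 0))
          else 0)))
  else 0

/-- STEP 2: `[m] term A i u v = termCoeff A m i u v` — extract `g₀, g₇, g₆, g₅, g₄, g₃, g₂`, then read off `g₁`
(the `i ∉ vars (…)` side conditions are discharged syntactically, cert-2 g7's recipe). -/
theorem coeff_term (A : Fin 8 → ℕ) (i u v : ℕ) (m : Fin 8 →₀ ℕ) :
    coeff m (term A i u v) = termCoeff A m i u v := by
  unfold term termCoeff
  -- g₀ (prefix `X 0 ^ i`, single factor `(X 0 + (X 1 + X 2 + X 3)) ^ A 1`)
  rw [coeff_X_pow_mul_X_add_pow_mul (0 : Fin 8) ?_ ?_]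
  rotate_left
  · repeat (first
      | with_reducible exact (notMem_vars_X_and (by decide)).1
      | with_reducible apply notMem_vars_mul
      | with_reducible refine (notMem_vars_pow_and ?_ _).1
      | with_reducible apply notMem_vars_add)
  · repeat (first
      | with_reducible exact (notMem_vars_X_and (by decide)).1
      | with_reducible apply notMem_vars_mul
      | with_reducible refine (notMem_vars_pow_and ?_ _).1
      | with_reducible apply notMem_vars_add)
  by_cases h0 : i ≤ m 0
  swap
  · rw [if_neg h0, if_neg h0]
  rw [if_pos h0, if_pos h0]
  congr 1
  -- g₇ : merge the two `(g₅+g₆+g₇)`-powers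
  set M₃ := A 1 - (m 0 - i) + A 2 with hM₃
  rw [show ((X 1 + X 2 + X 3) ^ (A 1 - (m 0 - i)) *
      (X 1 ^ (A 0 - i) * ((X 1 + X 2) ^ u * ((X 1 + X 2 + X 3) ^ A 2 *
        ((X 3 + X 4 + X 5) ^ (A 3 - u) * ((X 3 + X 4 + X 5) ^ A 4 * ((X 3 + X 4) ^ v *
          ((X 5 + X 6 + X 7) ^ (A 5 - v) * ((X 5 + X 6 + X 7) ^ A 6 * (X 5 + X 6) ^ A 7)))))))) : P8) =
      (X 7 + (X 5 + X 6)) ^ (A 5 - v + A 6) *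
        ((X 1 + X 2 + X 3) ^ M₃ * (X 1 ^ (A 0 - i) * ((X 1 + X 2) ^ u *
          ((X 3 + X 4 + X 5) ^ (A 3 - u + A 4) * ((X 3 + X 4) ^ v * (X 5 + X 6) ^ A 7))))) by
    rw [hM₃]; ring]
  rw [coeff_X_add_pow_mul (7 : Fin 8) ?_ ?_]
  rotate_left
  · repeat (first
      | with_reducible exact (notMem_vars_X_and (by decide)).1
      | with_reducible apply notMem_vars_mul
      | with_reducible refine (notMem_vars_pow_and ?_ _).1
      | with_reducible apply notMem_vars_add)
  · repeat (first
      | with_reducible exact (notMem_vars_X_and (by decide)).1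
      | with_reducible apply notMem_vars_mul
      | with_reducible refine (notMem_vars_pow_and ?_ _).1
      | with_reducible apply notMem_vars_add)
  have hm7 : (m.erase 0) 7 = m 7 := Finsupp.erase_ne (by decide)
  rw [hm7]
  congr 1
  -- g₆ : merge with `(g₅+g₆)^{A 7}`
  rw [show ((X 5 + X 6) ^ (A 5 - v + A 6 - m 7) *
      ((X 1 + X 2 + X 3) ^ M₃ * (X 1 ^ (A 0 - i) * ((X 1 + X 2) ^ u *
        ((X 3 + X 4 + X 5) ^ (A 3 - u + A 4) * ((X 3 + X 4) ^ v * (X 5 + X 6) ^ A 7))))) : P8) =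
      (X 6 + X 5) ^ (A 5 - v + A 6 - m 7 + A 7) *
        ((X 1 + X 2 + X 3) ^ M₃ * (X 1 ^ (A 0 - i) * ((X 1 + X 2) ^ u *
          ((X 3 + X 4 + X 5) ^ (A 3 - u + A 4) * (X 3 + X 4) ^ v)))) by ring]
  rw [coeff_X_add_pow_mul (6 : Fin 8) ?_ ?_]
  rotate_left
  · repeat (first
      | with_reducible exact (notMem_vars_X_and (by decide)).1
      | with_reducible apply notMem_vars_mul
      | with_reducible refine (notMem_vars_pow_and ?_ _).1
      | with_reducible apply notMem_vars_add)
  · repeat (first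
      | with_reducible exact (notMem_vars_X_and (by decide)).1
      | with_reducible apply notMem_vars_mul
      | with_reducible refine (notMem_vars_pow_and ?_ _).1
      | with_reducible apply notMem_vars_add)
  have hm6 : ((m.erase 0).erase 7) 6 = m 6 := by simp
  rw [hm6]
  congr 1
  -- g₅ : prefix `X 5 ^ c`, single factor `(X 5 + (X 3 + X 4)) ^ (A 3 - u + A 4)`
  set c := A 5 - v + A 6 - m 7 + A 7 - m 6 with hc
  rw [show (X 5 ^ c * ((X 1 + X 2 + X 3) ^ M₃ * (X 1 ^ (A 0 - i) * ((X 1 + X 2) ^ u *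
      ((X 3 + X 4 + X 5) ^ (A 3 - u + A 4) * (X 3 + X 4) ^ v)))) : P8) =
      X 5 ^ c * ((X 5 + (X 3 + X 4)) ^ (A 3 - u + A 4) *
        ((X 1 + X 2 + X 3) ^ M₃ * (X 1 ^ (A 0 - i) * ((X 1 + X 2) ^ u * (X 3 + X 4) ^ v)))) by ring]
  rw [coeff_X_pow_mul_X_add_pow_mul (5 : Fin 8) ?_ ?_]
  rotate_left
  · repeat (first
      | with_reducible exact (notMem_vars_X_and (by decide)).1
      | with_reducible apply notMem_vars_mul
      | with_reducible refine (notMem_vars_pow_and ?_ _).1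
      | with_reducible apply notMem_vars_add)
  · repeat (first
      | with_reducible exact (notMem_vars_X_and (by decide)).1
      | with_reducible apply notMem_vars_mul
      | with_reducible refine (notMem_vars_pow_and ?_ _).1
      | with_reducible apply notMem_vars_add)
  have hm5 : (((m.erase 0).erase 7).erase 6) 5 = m 5 := by simp
  rw [hm5]
  by_cases h5 : c ≤ m 5
  swap
  · rw [if_neg h5, if_neg h5]
  rw [if_pos h5, if_pos h5]
  congr 1
  -- g₄ : merge the two `(g₃+g₄)`-powers
  set K := A 3 - u + A 4 - (m 5 - c) + v with hK
  rw [show ((X 3 + X 4) ^ (A 3 - u + A 4 - (m 5 - c)) *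
      ((X 1 + X 2 + X 3) ^ M₃ * (X 1 ^ (A 0 - i) * ((X 1 + X 2) ^ u * (X 3 + X 4) ^ v))) : P8) =
      (X 4 + X 3) ^ K * ((X 1 + X 2 + X 3) ^ M₃ * (X 1 ^ (A 0 - i) * (X 1 + X 2) ^ u)) by
    rw [hK]; ring]
  rw [coeff_X_add_pow_mul (4 : Fin 8) ?_ ?_]
  rotate_left
  · repeat (first
      | with_reducible exact (notMem_vars_X_and (by decide)).1
      | with_reducible apply notMem_vars_mul
      | with_reducible refine (notMem_vars_pow_and ?_ _).1
      | with_reducible apply notMem_vars_add)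
  · repeat (first
      | with_reducible exact (notMem_vars_X_and (by decide)).1
      | with_reducible apply notMem_vars_mul
      | with_reducible refine (notMem_vars_pow_and ?_ _).1
      | with_reducible apply notMem_vars_add)
  have hm4 : ((((m.erase 0).erase 7).erase 6).erase 5) 4 = m 4 := by simp
  rw [hm4]
  congr 1
  -- g₃ : prefix `X 3 ^ d`, single factor `(X 3 + (X 1 + X 2)) ^ M₃`
  set d := K - m 4 with hd
  rw [show (X 3 ^ d * ((X 1 + X 2 + X 3) ^ M₃ * (X 1 ^ (A 0 - i) * (X 1 + X 2) ^ u)) : P8) =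
      X 3 ^ d * ((X 3 + (X 1 + X 2)) ^ M₃ * (X 1 ^ (A 0 - i) * (X 1 + X 2) ^ u)) by ring]
  rw [coeff_X_pow_mul_X_add_pow_mul (3 : Fin 8) ?_ ?_]
  rotate_left
  · repeat (first
      | with_reducible exact (notMem_vars_X_and (by decide)).1
      | with_reducible apply notMem_vars_mul
      | with_reducible refine (notMem_vars_pow_and ?_ _).1
      | with_reducible apply notMem_vars_add)
  · repeat (first
      | with_reducible exact (notMem_vars_X_and (by decide)).1
      | with_reducible apply notMem_vars_mul
      | with_reducible refine (notMem_vars_pow_and ?_ _).1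
      | with_reducible apply notMem_vars_add)
  have hm3 : (((((m.erase 0).erase 7).erase 6).erase 5).erase 4) 3 = m 3 := by simp
  rw [hm3]
  by_cases h3 : d ≤ m 3
  swap
  · rw [if_neg h3, if_neg h3]
  rw [if_pos h3, if_pos h3]
  congr 1
  -- g₂ : merge the two `(g₁+g₂)`-powers
  set L := M₃ - (m 3 - d) + u with hL
  rw [show ((X 1 + X 2) ^ (M₃ - (m 3 - d)) * (X 1 ^ (A 0 - i) * (X 1 + X 2) ^ u) : P8) =
      (X 2 + X 1) ^ L * X 1 ^ (A 0 - i) by rw [hL]; ring]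
  rw [coeff_X_add_pow_mul (2 : Fin 8) ?_ ?_]
  rotate_left
  · repeat (first
      | with_reducible exact (notMem_vars_X_and (by decide)).1
      | with_reducible apply notMem_vars_mul
      | with_reducible refine (notMem_vars_pow_and ?_ _).1
      | with_reducible apply notMem_vars_add)
  · repeat (first
      | with_reducible exact (notMem_vars_X_and (by decide)).1
      | with_reducible apply notMem_vars_mul
      | with_reducible refine (notMem_vars_pow_and ?_ _).1
      | with_reducible apply notMem_vars_add)
  have hm2 : ((((((m.erase 0).erase 7).erase 6).erase 5).erase 4).erase 3) 2 = m 2 := by simp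
  rw [hm2, idx_eq]
  congr 1
  -- g₁ forced
  rw [← pow_add, coeff_X_pow_single]

/-! ### The closed form and the diagonal -/

/-- **The closed 3-fold form** of the coefficient of `g^B` in `vimSpanProd9 A`. -/
def ctSum9 (A : Fin 8 → ℕ) (B : Fin 8 → ℕ) : ℤ :=
  ∑ i ∈ range (A 0 + 1), ∑ u ∈ range (A 3 + 1), ∑ v ∈ range (A 5 + 1),
    (((A 0).choose i : ℤ) * ((A 3).choose u * (A 5).choose v)) * termCoeff A B i u v

/-- **`[g^m] vimSpanProd9 A = ctSum9 A m`** for every exponent vector `A` and every monomial `m`. -/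
theorem coeff_vimSpanProd9 (A : Fin 8 → ℕ) (m : Fin 8 →₀ ℕ) :
    coeff m (vimSpanProd9 A) = ctSum9 A m := by
  rw [vimSpanProd9_eq_sum3]
  simp only [coeff_sum, coeff_C_mul, coeff_term]
  rfl

/-- The same with the monomial given as a function `B : Fin 8 → ℕ`. -/
theorem coeff_vimSpanProd9' (A : Fin 8 → ℕ) (B : Fin 8 → ℕ) :
    coeff (Finsupp.equivFunOnFinite.symm B) (vimSpanProd9 A) = ctSum9 A B := by
  rw [coeff_vimSpanProd9]
  simp

/-- Every `termCoeff` is non-negative. -/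
theorem termCoeff_nonneg (A : Fin 8 → ℕ) (B : Fin 8 → ℕ) (i u v : ℕ) : 0 ≤ termCoeff A B i u v := by
  unfold termCoeff
  split_ifs <;> positivity

/-- All coefficients of `vimSpanProd9 A` are non-negative. -/
theorem coeff_vimSpanProd9_nonneg (A : Fin 8 → ℕ) (m : Fin 8 →₀ ℕ) : 0 ≤ coeff m (vimSpanProd9 A) := by
  rw [coeff_vimSpanProd9]
  unfold ctSum9
  refine Finset.sum_nonneg fun i _ => Finset.sum_nonneg fun u _ => Finset.sum_nonneg fun v _ => ?_
  exact mul_nonneg (by positivity) (termCoeff_nonneg A m i u v)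

/-- On the diagonal the summand of `ctSum9` is fam-tele g13's chain summand
`C(n,i)²C(n+i,n)C(n+i,u) · C(n,u)C(2n−u,n) · C(2n−u,v)C(n,v)C(2n−v,n)²`. -/
theorem termCoeff_diag (n i u v : ℕ) (hi : i < n + 1) (hu : u < n + 1) (hv : v < n + 1) :
    ((n.choose i : ℤ) * (n.choose u * n.choose v)) * termCoeff (fun _ => n) (fun _ => n) i u v =
      ((n.choose i ^ 2 * (n + i).choose n * (n + i).choose u) *
        (n.choose u * (2 * n - u).choose n) * ((2 * n - u).choose v * n.choose v * (2 * n - v).choose n ^ 2) : ℕ) := by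
  unfold termCoeff
  have hN7 : n - v + n = 2 * n - v := by omega
  have hc : 2 * n - v - n = n - v := by omega
  have h5 : n - (n - v) = v := by omega
  have hN5 : n - u + n = 2 * n - u := by omega
  have hK : 2 * n - u - v + v = 2 * n - u := by omega
  have hd : 2 * n - u - n = n - u := by omega
  have hM3 : n - (n - i) + n = n + i := by omega
  have h3 : n - (n - u) = u := by omega
  have hL : n + i - u + u = n + i := by omega
  have hfin : n + i - n + (n - i) = n := by omega
  simp only [hN7, hc, h5, hN5, hK, hd, hM3, h3, hL, hfin, Nat.sub_le, ↓reduceIte,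
    show i ≤ n by omega, Nat.choose_symm (show i ≤ n by omega)]
  push_cast
  ring

/-- `List.range`-sums as `Finset.range`-sums. -/
theorem list_range_map_sum (f : ℕ → ℕ) (k : ℕ) : ((List.range k).map f).sum = ∑ x ∈ range k, f x := by
  induction k with
  | zero => simp
  | succ k ih => rw [List.range_succ, List.map_append, List.sum_append, Finset.sum_range_succ, ih]; simp

/-- fam-tele g13's `J` as a `Finset` triple sum (outer index `u`, then the `M₁`-index `i`, then the `M₂`-index `v`). -/
theorem J_eq_sum3 (n : ℕ) :
    (VIMTorus.J n : ℤ) = ∑ u ∈ range (n + 1), ∑ i ∈ range (n + 1), ∑ v ∈ range (n + 1),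
      (((n.choose i ^ 2 * (n + i).choose n * (n + i).choose u) *
        (n.choose u * (2 * n - u).choose n) * ((2 * n - u).choose v * n.choose v * (2 * n - v).choose n ^ 2) : ℕ) : ℤ) := by
  unfold VIMTorus.J VIMTorus.M₁ VIMTorus.M₂
  simp only [list_range_map_sum]
  push_cast
  refine Finset.sum_congr rfl fun u _ => ?_
  simp only [Finset.mul_sum, Finset.sum_mul]
  -- `simp` nests the `M₂`-index outside the `M₁`-index; swap them on the left-hand side only
  refine Eq.trans Finset.sum_comm ?_
  refine Finset.sum_congr rfl fun i _ => Finset.sum_congr rfl fun v _ => ?_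
  ring

/-- **The VIM torus period IS the gauge-9 dual constant term:** `[g₀ⁿ⋯g₇ⁿ] vimSpanProd9 (n,…,n) = J n` for every `n`. -/
theorem coeff_diag_eq_J (n : ℕ) :
    coeff (Finsupp.equivFunOnFinite.symm fun _ => n) (vimSpanProd9 fun _ => n) = (VIMTorus.J n : ℤ) := by
  rw [coeff_vimSpanProd9', J_eq_sum3]
  unfold ctSum9
  calc ∑ i ∈ range (n + 1), ∑ u ∈ range (n + 1), ∑ v ∈ range (n + 1),
        (((n.choose i : ℤ) * ((n.choose u) * (n.choose v))) * termCoeff (fun _ => n) (fun _ => n) i u v)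
      = ∑ i ∈ range (n + 1), ∑ u ∈ range (n + 1), ∑ v ∈ range (n + 1),
          (((n.choose i ^ 2 * (n + i).choose n * (n + i).choose u) * (n.choose u * (2 * n - u).choose n) *
            ((2 * n - u).choose v * n.choose v * (2 * n - v).choose n ^ 2) : ℕ) : ℤ) := by
        refine Finset.sum_congr rfl fun i hi => Finset.sum_congr rfl fun u hu => Finset.sum_congr rfl fun v hv => ?_
        exact termCoeff_diag n i u v (Finset.mem_range.mp hi) (Finset.mem_range.mp hu) (Finset.mem_range.mp hv)
    _ = _ := Finset.sum_comm

/-- Kernel instance: the `n = 1` dual constant term in gauge 9 is `61 = J 1` (= `A 1`, the leading coefficient of the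
first VIM form, `Families/CellularVIMRecurrenceLaws.A_one`; and = P2 g6's gauge-6 count `dualCount vimSpans 1⁸`,
`Families/DualConstantTermVIM`). -/
theorem coeff_diag_one : coeff (Finsupp.equivFunOnFinite.symm fun _ => 1) (vimSpanProd9 fun _ => 1) = 61 := by
  rw [coeff_diag_eq_J, VIMTorus.J_one]
  norm_num

end VIMCT9

end Summit.KontsevichZagierPeriods.Zeta5Search.Families.Cellular
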